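import Summits.RiemannHypothesis.RiemannHypothesis.Theorems.JensenPolynomialsFarSplitGlue
import Summits.RiemannHypothesis.RiemannHypothesis.Theorems.JensenPolynomialsFarGumbel
import Summits.RiemannHypothesis.RiemannHypothesis.Theorems.JensenPolynomialsXiCumulantSkew98Far
import Summits.RiemannHypothesis.RiemannHypothesis.Theorems.JensenPolynomialsXiCumulantMajorantCapFar
import Summits.RiemannHypothesis.RiemannHypothesis.Theorems.JensenHermiteSignTest
import Summits.RiemannHypothesis.RiemannHypothesis.Theorems.JensenPolynomialsXiDeltaSqPos
import Summits.RiemannHypothesis.RiemannHypothesis.Theorems.JensenSignTestPointwiseFar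
import Summits.RiemannHypothesis.RiemannHypothesis.Theorems.JensenWindowTable

/-!
# CAPSTONE of rung J-P(P1′): `JensenCubicRangeTwo` — the cubic hyperbolicity range of ξ's Jensen polynomials (RH-FREE)

RH-FREE PROOF-OF-DATA (ladder LADDER-RH, column JENSEN, rung J-P(P1′), D-0059/D-0061).  For all `d ≥ 3`
and `n ≥ 2d³` the Jensen polynomial `J^{d,n}_γ` of `γ = xiTaylorCoeff` (the Taylor data of `ξ` at `½`) is
hyperbolic — the registered rung leaf
`Summit.RiemannHypothesis.RiemannHypothesis.Theorems.JensenPolynomials.JensenCubicRangeTwo`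
(`Theorems/JensenPolynomialsDefs.lean`), obtained by applying the route's deciding theorem
`Summit.RiemannHypothesis.RiemannHypothesis.Theses.JensenPolynomials.closes`
(route `route-RiemannHypothesis-JensenPolynomials`, rev 13) to its five binders, each a tree theorem:

* `h₁` `XiGorttwCoeffSmallFar` (stmt-19459) — `xiGorttwCoeffSmallFar_item` below = the glue
  `xiGorttwCoeffSmallFarOfSplit_item` (stmt-19473, `Theorems/JensenPolynomialsFarSplitGlue.lean`) applied to the
  three FAR children: B1-rel far `XiWindowZeroFreeRelFar` (stmt-19465, line `far-gumbel`,
  `Cruxes.XiWindowZeroFreeRelFar.FarGumbel.XiWindowZeroFreeRelFar_of`, `Theorems/JensenPolynomialsFarGumbel.lean`),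
  C1a far `XiCumulantSkew98Far` (stmt-19466, `SkewFar.xiCumulantSkew98Far_item`), C2⁺_gen far
  `XiCumulantMajorantCapFar` (stmt-19472, `CapCert.xiCumulantMajorantCapFar_item`);
* `h₃` `HermiteCriticalRatioWindow` (stmt-19711) — `hermiteCriticalRatioWindow_item` (`Theorems/JensenWindowTable.lean`);
* `h₄` `XiDeltaSqPos` (stmt-19712) — `xiDeltaSqPos_item` (`Theorems/JensenPolynomialsXiDeltaSqPos.lean`);
* `h₆` `HermiteSignTestSound` (stmt-19714) — `hermiteSignTestSound_item` (`Theorems/JensenHermiteSignTest.lean`);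
* `h₇` `SignTestOfCoeffSmallFromFar` (stmt-19460) — `signTestOfCoeffSmallFromFar_item`
  (`Theorems/JensenSignTestPointwiseFar.lean`).

Inside `closes`: `d ≤ 10⁶` is the kernel certificate `jensenPoly_xiTaylorCoeff_splits_allShifts_of_le_1e6'`
(all shifts), and `d > 10⁶ ⇒ n ≥ 2d³ > 2·10¹⁸` is the FAR regime of the Hermite sign test (GORTTW).

`assembly_item` closes the route's Assembly item stmt-RiemannHypothesis-19715 (`Theses.JensenPolynomials.Assembly`,
an implication whose conclusion is the leaf).

WHAT THIS IS NOT: a hyperbolicity RANGE `n ≥ 2d³` for the explicit real sequence `γ`; by the tree's barrier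
entries `Literature.Barriers.RiemannHypothesis.JensenPolynomials*` (Farmer 2022) such a range carries no
information about the zeros of `ζ`; nothing here bears on the truth of RH.  References: [GORZPNAS2019],
[GriffinEtAl2022] (GORTTW), cell rh-jensen HOME/rh-jensen-theory/THEORY-JENSEN.md §10.
-/

set_option linter.dupNamespace false

namespace Summit.RiemannHypothesis.RiemannHypothesis.Theorems.JensenPolynomials

/-- **Item theorem (stmt-RiemannHypothesis-19459, RH-FREE).** `XiGorttwCoeffSmallFar`: for all `d ≥ 3` and
`n ≥ max(2·10¹⁸, 2d³)` the two `ρ_win`-weighted `ℓ¹` sums of GORTTW's Hermite coefficients of `γ = xiTaylorCoeff`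
are `< 1` — the glue `xiGorttwCoeffSmallFarOfSplit_item` applied to the three landed FAR children. -/
theorem xiGorttwCoeffSmallFar_item :
    Summit.RiemannHypothesis.RiemannHypothesis.Theses.JensenPolynomials.XiGorttwCoeffSmallFar :=
  xiGorttwCoeffSmallFarOfSplit_item
    Summit.RiemannHypothesis.RiemannHypothesis.Cruxes.XiWindowZeroFreeRelFar.FarGumbel.XiWindowZeroFreeRelFar_of
    SkewFar.xiCumulantSkew98Far_item CapCert.xiCumulantMajorantCapFar_item

/-- **CAPSTONE (rung J-P(P1′), RH-FREE): `JensenCubicRangeTwo` holds** — for all `d ≥ 3` and all `n ≥ 2d³`,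
the Jensen polynomial `J^{d,n}_γ` of `ξ`'s Taylor data `γ = xiTaylorCoeff` is hyperbolic (all roots real):
the route's deciding theorem `Theses.JensenPolynomials.closes` applied to its five closed binders. -/
theorem jensenCubicRangeTwo_proof :
    Summit.RiemannHypothesis.RiemannHypothesis.Theorems.JensenPolynomials.JensenCubicRangeTwo :=
  Summit.RiemannHypothesis.RiemannHypothesis.Theses.JensenPolynomials.closes xiGorttwCoeffSmallFar_item
    hermiteCriticalRatioWindow_item xiDeltaSqPos_item hermiteSignTestSound_item
    signTestOfCoeffSmallFromFar_item

/-- **Item theorem (stmt-RiemannHypothesis-19715, the route's Assembly, RH-FREE):** the implication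
`XiGorttwCoeffSmallAnalytic → XiGorttwCoeffSmallTable → HermiteCriticalRatioWindow → XiDeltaSqPos →
SignTestBlueprintWindow → HermiteSignTestSound → JensenCubicRangeTwo` holds — its conclusion is the proved leaf. -/
theorem assembly_item :
    Summit.RiemannHypothesis.RiemannHypothesis.Theses.JensenPolynomials.Assembly :=
  fun _ _ _ _ _ _ => jensenCubicRangeTwo_proof

end Summit.RiemannHypothesis.RiemannHypothesis.Theorems.JensenPolynomials
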